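import Summits.BirchSwinnertonDyer.BirchSwinnertonDyer.Theorems.PrintX11aUpperNonSurjThreeCorollary18OfMazur
import Summits.BirchSwinnertonDyer.BirchSwinnertonDyer.Theorems.PrintX11aUpperNonSurjThreeRankZeroNoGZK
import HarnessLib

/-!
# Route `PrintX11a`, crux U3 `UpperNonSurjThree` (item stmt-BirchSwinnertonDyer-20613): the rank-`0` Euler-half engine
# WITHOUT Gross–Zagier–Kolyvagin — `rank E(ℚ) = 0` and `#Ш[p^∞] < ∞` read off Kato's divisibility by the tree's control
# theorem and Stein–Wuthrich 6.1 — and the U3 body from NINE print-exact named facts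

Cell `bsd-print-x11a`, width seat bsd-line-x11a-p2 g3 (`--supports stmt-BirchSwinnertonDyer-20613 --as helper`). Theorems
only; Theses-free; BSD is not proved by any of this; nothing is asserted about any curve; item 20613 does not close by this file.

THE POINT. K2's rank-`0` engine `X11b.missingUpperBoundAt_of_multDivisibilityAt_of_analyticRank_eq_zero` (stepL; and its
sharpening `…_of_newform`, p619657) reads Gross–Zagier–Kolyvagin (`rank_eq_analyticRank_of_analyticRank_le_one`, conjunct 4 of
item 19949) for two things only: `rank E(ℚ) = 0` (so `E(ℚ)` is finite, `Reg = 1`, the §4.2 height is the zero pairing) and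
`Ш(E/ℚ)` finite (so `#Ш ∼ #Ш[p^∞]`). Both are redundant in the presence of the typed divisibility `X11b.MultDivisibilityAt W p`
it already consumes ("Kato's theorem implies Kolyvagin's in analytic rank `0`", at the prime `p`):
* `rank E(ℚ) = 0`: the divisibility gives `h ∈ char_Λ X(E/ℚ_∞)` with `ι h = ϖ·L` (non-split; `ι(T·h) = ϖ·L` split), and
  `h(0) ≠ 0` because `L(0) = 2[0]⁺_f ≠ 0` (non-split, `L(E,1) ≠ 0`) resp. `[T¹]L · log_p κ(γ) = 𝓛_p · [0]⁺_f ≠ 0` (split: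
  Greenberg–Stevens ∕ Kobayashi + `𝓛_p ≠ 0`, tree theorem `LInvariant_ne_zero_holds`); the tree's CONTROL THEOREM
  `WeierstrassCurve.mordellWeilRank_le_order_of_mem_charIdeal` (`rank E(ℚ) ≤ ord_T h`, Mazur ∕ Greenberg Lemma 3.1 + the
  structure theorem; = clause 1 of Stein–Wuthrich 6.1, PROVED in the tree) gives `rank E(ℚ) = 0`.
* `#Ш[p^∞] < ∞`: clause 2 of Stein–Wuthrich 6.1 (`ord_T f_E = rank ↔ Schneider ∧ #Ш[p^∞] < ∞`) at `ord_T f_E = 0 = rank`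
  with the zero pairing (`RankZeroHeightFree`), Schneider being `Reg_p = 1 ≠ 0`.
* `Ш` itself need not be finite: `W.shaOrder = Nat.card Ш` is `0` on an infinite `Ш` and then `ord_p #Ш = 0`, while the
  leading-term identity still bounds `ord_p ∏c_v − 2 ord_p #E(ℚ)_tors ≤ ord_p (L(E,1)/Ω_E)`; and Miller's `#Ш_an` is the
  rational `(L(E,1)/Ω_E)·#E(ℚ)²/∏c_v` as soon as `rank E(ℚ) = 0` (`Reg = 1`).
The lemmas (bookkeeping, packaging, the two leading-term lemmas) are `PrintX11aUpperNonSurjThreeRankZeroNoGZK.lean`; here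
(§4) **`X11b.missingUpperBoundAt_of_multDivisibilityAt_of_analyticRank_eq_zero_noGZK`**: for `W/ℚ` globally minimal, `p`
an ODD multiplicative prime with `ord_{s=1}L(E,s) = 0`, `X11b.MultDivisibilityAt W p ⟹ Typed.MissingUpperBoundAt W p` from
Stein–Wuthrich 6.1 ×2, modularity (`exists_isNewformOf`) and — at a split `p` only — Greenberg–Stevens; NO Gross–Zagier–Kolyvagin.
(§5) **`ClassX11a.upperNonSurjThree_body_of_nineFacts`**: the body of U3 from NINE print-exact named facts — Stein–Wuthrich 6.1
×2, Greenberg–Stevens ∕ Kobayashi, Kato 12.4, modularity, Kato §17.13 V′ ∕ VI′ ∕ XI′, Mazur Cor. 4.1 (counts: 14 in p616233, 12 in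
p619657, 10 in `…Corollary18OfMazur`); the Euler half of BSD at these pairs no longer reads Heegner points.
References (locators only): [cite: SteinWuthrich2013, Thm. 6.1 (p. 20), §4.2] [cite: BalakrishnanMullerStein2015, Thm. 1.7]
[cite: GreenbergLNM1716, Lemma 3.1, §4] [cite: Kobayashi2006DocMath, Cor. 4.2 (p. 575)] [cite: Miller2011LMS, Def. 1.1 and §1]
[cite: Kato2004Asterisque, Thm. 12.4 (p. 221), §17.13 (pp. 279–280)] [cite: Mazur1978, Cor. 4.1].
-/

set_option autoImplicit false

noncomputable section

open scoped Classical MatrixGroups ModularForm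

open CongruenceSubgroup WeierstrassCurve
  Literature.NumberTheory.EllipticCurves
  Literature.NumberTheory.EllipticCurves.ModularForms
  Literature.NumberTheory.EllipticCurves.Rank1Residual
  Literature.NumberTheory.EllipticCurves.Rank1Residual.Typed
  Literature.NumberTheory.EllipticCurves.Wuthrich2014
  Literature.NumberTheory.EllipticCurves.SteinWuthrich2013
  Literature.NumberTheory.EllipticCurves.Greenberg1999
  Literature.NumberTheory.EllipticCurves.Kato2004
  Summit.BirchSwinnertonDyer.Rank1Residual
  Summit.BirchSwinnertonDyer.Rank1Residual.RankZeroHeightFree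
  Summit.BirchSwinnertonDyer.BirchSwinnertonDyer.Theorems

namespace Summit.BirchSwinnertonDyer.Rank1Residual.X11b

/-! ### §4 The rank-`0` engine without Gross–Zagier–Kolyvagin -/

/-- **The rank-`0` engine without Gross–Zagier–Kolyvagin**: for `W/ℚ` globally minimal, `p` an ODD multiplicative prime with
`ord_{s=1} L(E,s) = 0`, `X11b.MultDivisibilityAt W p ⟹ Typed.MissingUpperBoundAt W p`, granted Stein–Wuthrich 2013 Thm. 6.1
(`hJs` ∕ `hJn`), modularity as `exists_isNewformOf` (entire `L`, parametrisation datum) and — ONLY at a split `p` — the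
exceptional-zero formula `hGS`. `rank E(ℚ) = 0`, `#Ш[p^∞] < ∞`, `Reg = 1` are produced inside (lemma file) from the divisibility by
the tree's control theorem; `Ш` need not be finite. Compare `missingUpperBoundAt_of_multDivisibilityAt_of_analyticRank_eq_zero`
(stepL) and `…_of_newform` (p619657), which read GZK. [cite: SteinWuthrich2013, Thm. 6.1 (p. 20) and §4.2]
[cite: Kobayashi2006DocMath, Cor. 4.2 (p. 575)] [cite: BalakrishnanMullerStein2015, Thm. 1.7] [cite: Miller2011LMS, Def. 1.1 and §1] -/
theorem missingUpperBoundAt_of_multDivisibilityAt_of_analyticRank_eq_zero_noGZK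
    (hJs : thm61_splitMultiplicative) (hJn : thm61_nonsplitMultiplicative) (hnf : exists_isNewformOf)
    (W : WeierstrassCurve ℚ) [W.IsElliptic] [W.IsGloballyMinimal] (p : ℕ) [Fact p.Prime]
    (hGS : W.HasSplitMultiplicativeReductionAtPrime p → greenberg_stevens (W := W) (p := p))
    (hp : p ≠ 2) (hmult : W.HasMultiplicativeReductionAtPrime p) (hr : W.analyticRank = 0)
    (hdiv : MultDivisibilityAt W p) : Typed.MissingUpperBoundAt W p := by
  have hmod : hasEntireLFunction_rat := WeierstrassCurve.hasEntireLFunction_rat_of_exists_isNewformOf hnf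
  have hpar : nonempty_modularParametrizationData :=
    nonempty_modularParametrizationData_of_modularity hnf IsNewformOf.exists_maninConstant_modularDegree_holds
  obtain ⟨κ, hκ, γ, hγ, hγ'⟩ := exists_isCyclotomic_isTopGenerator_isCyclotomicVariable_holds p
  obtain ⟨D⟩ := W.nonempty_selmerDualData_holds κ γ hγ
  haveI : NeZero (W.conductorNorm ℤ) := ⟨(W.conductorNorm_pos_holds).ne'⟩
  obtain ⟨Dm⟩ := hpar W
  obtain ⟨ϖ, hϖpos, hϖ, -⟩ := Dm.exists_rat_mul_realPeriodRat_eq_plusPeriod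
  obtain ⟨hX, hnsp, hsp⟩ := hdiv hκ hγ hγ' Dm.isNewformOf D ϖ hϖpos.ne' hϖ
  have hL1 : W.entireLFunction 1 ≠ 0 := (W.analyticRank_eq_zero_iff_holds (hmod W)).1 hr
  by_cases hsplit : W.HasSplitMultiplicativeReductionAtPrime p
  · obtain ⟨L, hL⟩ := exists_isSplitMultPAdicLFunctionOf hsplit Dm.isNewformOf
    obtain ⟨Dq⟩ := (nonempty_tateParameterData_iff_holds (W := W) (p := p)).mpr hsplit
    obtain ⟨hr0, ht⟩ := le_padicValRat_of_split_divisibility_rankZero_noGZK hJs W p (hGS hsplit)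
      LInvariant_ne_zero_holds hp hL1 Dq hκ hγ hγ' Dm.isNewformOf D ϖ hϖpos.ne' hϖ L hL hX (hsp hsplit L hL)
    exact missingUpperBoundAt_of_padicValRat_le_of_mordellWeilRank_eq_zero W p hL1 hr0 ht
  · obtain ⟨L, hL⟩ := exists_isMultPAdicLFunctionOf_neg_one_of_nonsplit Dm.isNewformOf hmult hsplit
    obtain ⟨q, ⟨hq0, hq1, hqj⟩, -⟩ := existsUnique_tateJ_eq_of_one_lt_norm
      (one_lt_norm_j_of_hasMultiplicativeReductionAtPrime (W := W) (p := p) hmult)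
    obtain ⟨hr0, ht⟩ := le_padicValRat_of_nonsplit_divisibility_rankZero_noGZK hJn W p hp hL1 hmult hsplit hq0 hq1
      hqj hκ hγ hγ' Dm.isNewformOf D ϖ hϖpos.ne' hϖ L hL hX (hnsp hsplit L hL)
    exact missingUpperBoundAt_of_padicValRat_le_of_mordellWeilRank_eq_zero W p hL1 hr0 ht

end Summit.BirchSwinnertonDyer.Rank1Residual.X11b

/-! ### §5 The body of U3 from nine print-exact named facts -/

namespace Summit.BirchSwinnertonDyer.Rank1Residual.ClassX11a

/-- **Per pair, nine facts minus Greenberg–Stevens at a non-split `3`.** At an X11a pair `(W, 3)` (`r_an = 0`, `3 ∥ N`, `E[3]`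
irreducible) with `ρ̄_{E,3}` not surjective: `ord₃ #Ш ≤ ord₃ #Ш_an` (`Typed.MissingUpperBoundAt W 3`), modulo EIGHT named facts
plus — only when the reduction at `3` is split — the exceptional-zero formula at the pair; no Gross–Zagier–Kolyvagin.
[cite: Kato2004Asterisque, Thm. 12.4 (p. 221), §17.13 (pp. 279–280)] [cite: SteinWuthrich2013, Thm. 6.1 (p. 20)]
[cite: Mazur1978, Cor. 4.1] [cite: GreenbergLNM1716, §1 Conj. 1.11 (p. 58)] -/
theorem missingUpperBoundAt_three_of_not_surj_of_nineFacts
    (hJs : thm61_splitMultiplicative) (hJn : thm61_nonsplitMultiplicative)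
    (h12 : Kato2004.thm12_4) (hnf : exists_isNewformOf)
    (hns' : Kato2004.exists_multDivisibilityInputs_nonsplit_contra)
    (hsp' : Kato2004.exists_multDivisibilityInputs_split_contra)
    (hfine' : Kato2004.exists_multDivisibilityInputs_fine_contra) (hMz : mazur_not_dvd_maninConstant_of_odd)
    (W : WeierstrassCurve ℚ) [W.IsElliptic] [W.IsGloballyMinimal] [Fact (Nat.Prime 3)]
    (hGS : W.HasSplitMultiplicativeReductionAtPrime 3 → greenberg_stevens (W := W) (p := 3))
    (hX : ClassX11a W 3) (hns : ¬ Surj W 3) : Typed.MissingUpperBoundAt W 3 :=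
  X11b.missingUpperBoundAt_of_multDivisibilityAt_of_analyticRank_eq_zero_noGZK hJs hJn hnf W 3 hGS hX.2.1 hX.2.2.1 hX.1
    (X11b.multDivisibilityAt_three_of_not_surj_of_sixFacts h12 hnf hns' hsp' hfine' hMz W hX.2.2.1 hX.2.2.2.1 hns)

/-- **The body of U3 from NINE print-exact named facts (μ-road, whole domain, contragredient packages; Cor. 18, Greenberg 1.5
and Gross–Zagier–Kolyvagin discharged).** At every X11a pair `(W, 3)` with `ρ̄_{E,3}` not surjective: `ord₃ #Ш ≤ ord₃ #Ш_an`
(`Typed.MissingUpperBoundAt W 3`), modulo Stein–Wuthrich 6.1 ×2 (`hJs`, `hJn`), Greenberg–Stevens ∕ Kobayashi (`hGS`), Kato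
12.4 (`h12`), modularity (`hnf`), Kato §17.13 V′ ∕ VI′ ∕ XI′ (`hns'`, `hsp'`, `hfine'`), Mazur Cor. 4.1 (`hMz`). The analytic
`μ₃ = 0` input is the THEOREM `MultThreeMuAn.muAnZeroAt_three_of_mult_of_irr`; `rank E(ℚ) = 0` and `#Ш[3^∞] < ∞` come from
the Kato divisibility by the control theorem, not from Heegner points. Counts: 14 (p616233) → 12 (p619657) → 10
(`upperNonSurjThree_body_of_tenFacts`) → 9. [cite: Kato2004Asterisque, §17.13 (pp. 279–280)] [cite: SteinWuthrich2013, Thm. 6.1 (p. 20)]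
[cite: Mazur1978, Cor. 4.1] [cite: GreenbergLNM1716, §1 Conj. 1.11 (p. 58)] [cite: Kobayashi2006DocMath, Cor. 4.2 (p. 575)] -/
theorem upperNonSurjThree_body_of_nineFacts
    (hJs : thm61_splitMultiplicative) (hJn : thm61_nonsplitMultiplicative)
    (hGS : ∀ (W : WeierstrassCurve ℚ) [W.IsElliptic] [W.IsGloballyMinimal] (p : ℕ) [Fact p.Prime],
      greenberg_stevens (W := W) (p := p))
    (h12 : Kato2004.thm12_4) (hnf : exists_isNewformOf)
    (hns' : Kato2004.exists_multDivisibilityInputs_nonsplit_contra)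
    (hsp' : Kato2004.exists_multDivisibilityInputs_split_contra)
    (hfine' : Kato2004.exists_multDivisibilityInputs_fine_contra) (hMz : mazur_not_dvd_maninConstant_of_odd) :
    ∀ (W : WeierstrassCurve ℚ) [W.IsElliptic] [W.IsGloballyMinimal] (p : ℕ) [Fact p.Prime],
      ClassX11a W p → ¬ Surj W p → p = 3 → Typed.MissingUpperBoundAt W p := by
  intro W _ _ p _ hX hns hp3
  subst hp3
  exact missingUpperBoundAt_three_of_not_surj_of_nineFacts hJs hJn h12 hnf hns' hsp' hfine' hMz W
    (fun _ => hGS W 3) hX hns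

end Summit.BirchSwinnertonDyer.Rank1Residual.ClassX11a

end
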